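import Mathlib
import Literature.Analysis.FluidPDE.TaoAveragedSobolev
import Literature.Analysis.FluidPDE.TaoAveragedCascade
import Summits.NavierStokesRegularity.NavierStokesRegularity.Theses.PerpetualPump

/-!
# Sketch — crux-ideate stmt-NavierStokesRegularity-1835 (AveragedTypeIBlowup), ideator 1, round 1

First-lemma signatures for the two idea cards (they need not be proved; they must elaborate).

* Card A `haar-averaged-exact-profile`: `haarCascadeForm`, `HaarCascadeCovariant`,
  `HaarCascadeIsAveraged`, and the transfer statement `ExactProfileBlowup → AveragedTypeIBlowup`
  in the weak form `ProfileTransfer`.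
* Card B `abrupt-threshold-shooting`: `ThresholdTypeIChain` (forward, single-scale-datum, Type-I
  blow-up of an autonomous Tao circuit — the ODE shadow of the crux) and the abstract shooting
  principle `shooting_principle` (proved, pure topology).
-/

noncomputable section

namespace Summit.NavierStokesRegularity.NavierStokesRegularity.Cruxes.AveragedTypeIBlowup.SketchIdeator1

open MeasureTheory Set Filter Topology
open Literature.Analysis.FluidPDE.Tao2016

local notation "ℝ³" => EuclideanSpace ℝ (Fin 3)

/-! ## Card A -/

/-- The **Haar (period-averaged) cascade form**: Tao's basic local cascade form (Def. 3.1) with the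
sum over the discrete scales `(1+ε₀)^n`, `n ∈ ℤ`, replaced by the integral over ALL scales
`(1+ε₀)^τ`, `τ ∈ ℝ` (Lebesgue measure in `τ` = Haar measure on the dilation group). It is the
average over `θ ∈ [0,1]` of the `(1+ε₀)^θ`-dilation conjugates of the basic form, hence exactly
covariant under every dilation. -/
def haarCascadeForm (ε₀ : ℝ) (ψ₁ ψ₂ ψ₃ : SchwartzMap ℝ³ ℝ³) (u v w : L2C) : ℂ :=
  ∫ τ : ℝ, (((1 + ε₀) ^ ((5 : ℝ) * τ / 2) : ℝ) : ℂ) *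
    (pairing u (dil ((1 + ε₀) ^ τ) (schwartzL2 ψ₁)) *
      pairing v (dil ((1 + ε₀) ^ τ) (schwartzL2 ψ₂)) *
      pairing w (dil ((1 + ε₀) ^ τ) (schwartzL2 ψ₃)))

/-- First lemma (A1): exact continuous scale covariance
`H(Dil_μ u, Dil_μ v, Dil_μ w) = μ^{5/2} H(u,v,w)` for every `μ > 0` (change of variable in `τ`;
compare Tao p. 14, where the discrete sum gives this only for `μ ∈ (1+ε₀)^ℤ`). -/
def HaarCascadeCovariant : Prop :=
  ∀ ε₀ : ℝ, 0 < ε₀ → ∀ ψ₁ ψ₂ ψ₃ : SchwartzMap ℝ³ ℝ³, ∀ μ : ℝ, 0 < μ → ∀ u v w : L2C,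
    haarCascadeForm ε₀ ψ₁ ψ₂ ψ₃ (dil μ u) (dil μ v) (dil μ w) =
      (((μ ^ ((5 : ℝ) / 2)) : ℝ) : ℂ) * haarCascadeForm ε₀ ψ₁ ψ₂ ψ₃ u v w

/-- First lemma (A2): Haar cascade forms with NARROW annular support
`{1 - ε₀/2 ≤ |ξ| ≤ 1 + ε₀/2}` are averaged Euler forms (every dilation conjugate by
`μ ∈ [1, 1+ε₀]` is again a local cascade form with parameter `ε₀`, Theorem 3.2 applies to each
with uniform moment bounds, and the `θ`-average of averaging data is an averaging datum). -/
def HaarCascadeIsAveraged : Prop :=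
  ∃ ε₁ : ℝ, 0 < ε₁ ∧ ∀ ε₀ : ℝ, 0 < ε₀ → ε₀ ≤ ε₁ →
    ∀ ψ₁ ψ₂ ψ₃ : SchwartzMap ℝ³ ℝ³,
      HasAnnularFourierSupport (ε₀ / 4) ψ₁ → HasAnnularFourierSupport (ε₀ / 4) ψ₂ →
      HasAnnularFourierSupport (ε₀ / 4) ψ₃ →
        ∃ 𝒜 : AveragingDatum, ∀ u v w, MemH10df u → MemH10df v → MemH10dfC w →
          𝒜.form u v w = haarCascadeForm ε₀ ψ₁ ψ₂ ψ₃ u v w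

/-- A finite real combination of Haar cascade forms. -/
def IsHaarCascadeCombination (ε₀ : ℝ) (T : L2C → L2C → L2C → ℂ) : Prop :=
  ∃ (k : ℕ) (c : Fin k → ℝ) (ψ : Fin k → Fin 3 → SchwartzMap ℝ³ ℝ³),
    (∀ j i, HasAnnularFourierSupport (ε₀ / 4) (ψ j i)) ∧
      ∀ u v w, T u v w = ∑ j, (c j : ℂ) * haarCascadeForm ε₀ (ψ j 0) (ψ j 1) (ψ j 2) u v w

/-- The Leray profile residual `N[U] = -ΔU + ½ U + ½ (y·∇)U` of a Schwartz profile `U`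
(backward self-similar ansatz `u(t,x) = (T-t)^{-1/2} U(x/√(T-t))` for `∂ₜu = Δu + B̃(u,u)`
turns into `B̃(U,U) = N[U]`). Mathlib's Laplacian on `𝓢` and the tree's `convect`. -/
def profileResidual (U : SchwartzMap ℝ³ ℝ³) (y : ℝ³) : ℝ³ :=
  -((Laplacian.laplacian U : SchwartzMap ℝ³ ℝ³) y) + (1 / 2 : ℝ) • U y +
    (1 / 2 : ℝ) • Literature.Analysis.FluidPDE.convect (fun z => z) (⇑U) y

/-- **C⁺ (card A's transfer target): an exactly self-similar Schwartz-profile blow-up.** There are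
`ε₀`, a symmetric Haar-cascade combination `T` with the cancellation property that is an averaged
Euler form, and a nonzero real divergence-free Schwartz profile `U` solving the averaged Leray
profile equation `⟨N[U], w⟩ = T(U,U,w)` for all `w ∈ H¹⁰_df ⊗ ℂ`. -/
def ExactProfileBlowup : Prop :=
  ∃ (ε₀ : ℝ) (T : L2C → L2C → L2C → ℂ) (𝒜 : AveragingDatum) (U : SchwartzMap ℝ³ ℝ³),
    0 < ε₀ ∧ IsHaarCascadeCombination ε₀ T ∧
    (∀ u v w, MemH10df u → MemH10df v → MemH10dfC w → 𝒜.form u v w = T u v w) ∧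
    𝒜.IsSymmetric ∧ 𝒜.HasCancellation ∧
    Literature.Analysis.FluidPDE.VectorCalculus.IsDivFree ⇑U ∧ U ≠ 0 ∧
    ∀ w : L2C, MemH10dfC w →
      ∫ y, cdot (Literature.Analysis.FunctionSpaces.EuclideanSpace.complexify (profileResidual U y))
          ((w : ℝ³ → EuclideanSpace ℂ (Fin 3)) y) =
        T (schwartzL2 U) (schwartzL2 U) w

/-- Card A's transfer statement: `C⁺ → C` (the exact self-similar solution
`u(t) = Dil_{(T-t)^{-1/2}}`-rescaling of `U` is a mild solution on `[0,T)` from the Schwartz datum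
`T^{-1/2}U(·/√T)`, Type I with `M = ‖U‖_∞`, and has no `H¹⁰`-continuous extension). -/
def ProfileTransfer : Prop :=
  ExactProfileBlowup →
    Summit.NavierStokesRegularity.NavierStokesRegularity.Theses.PerpetualPump.AveragedTypeIBlowup

/-! ## Card B -/

/-- **C_ode (card B's first lemma): forward Type-I blow-up of an autonomous Tao circuit from a
single-scale datum** — the ODE shadow of `AveragedTypeIBlowup` (compare the route's ancient/DSS
`CircuitPump`): for arbitrarily fine `lam` there are a circuit of Tao's class (4.3) (symmetric,
cyclic-cancelling structure constants, `α = 2/5`), a datum shape `X⁰` at scale `0`, an amplitude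
`A` (the THRESHOLD amplitude, found by shooting) and a time `T` such that the solution with datum
`A • X⁰ ⊗ δ_{n,0}` lives on `[0,T)`, is `H¹⁰`-regular before `T`, blows up at `T` in the `H¹⁰`
weight, and obeys the Type-I bound `lam^{3n/5}|X_{i,n}(t)| ≤ C/√(T-t)`. -/
def ThresholdTypeIChain : Prop :=
  ∀ lam₀ : ℝ, 1 < lam₀ → ∃ lam : ℝ, 1 < lam ∧ lam < lam₀ ∧
    ∃ (m : ℕ) (coeff : Fin m → Fin m → Fin m → Option (Fin 3) → ℝ) (X₀ : Fin m → ℝ) (A T : ℝ)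
      (X : Fin m → ℤ → ℝ → ℝ),
    let F : Fin m → ℤ → ℝ → ℝ := fun (i : Fin m) (n : ℤ) (t : ℝ) =>
      -(lam ^ ((4 / 5 : ℝ) * n)) * X i n t +
        ∑ i₁ : Fin m, ∑ i₂ : Fin m, ∑ μ : Option (Fin 3),
          coeff i₁ i₂ i μ * lam ^ ((n : ℝ) - (if μ = some 2 then 1 else 0)) *
            X i₁ (n + ((if μ = some 0 then 1 else 0) - (if μ = some 2 then 1 else 0))) t *
            X i₂ (n + ((if μ = some 1 then 1 else 0) - (if μ = some 2 then 1 else 0))) t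
    (∀ (i₁ i₂ i₃ : Fin m) (μ : Option (Fin 3)),
        coeff i₁ i₂ i₃ μ = coeff i₂ i₁ i₃ (Option.map (Equiv.swap (0 : Fin 3) 1) μ)) ∧
    (∀ (v : Fin 3 → Fin m) (μ : Option (Fin 3)),
        ∑ σ : Equiv.Perm (Fin 3), coeff (v (σ 0)) (v (σ 1)) (v (σ 2)) (Option.map σ.symm μ) = 0) ∧
    0 < A ∧ 0 < T ∧
    (∀ (i : Fin m) (n : ℤ), ContinuousOn (X i n) (Ico 0 T)) ∧
    (∀ (i : Fin m) (n : ℤ), ∀ t ∈ Ioo 0 T, HasDerivAt (X i n) (F i n t) t) ∧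
    (∀ (i : Fin m) (n : ℤ), X i n 0 = if n = 0 then A * X₀ i else 0) ∧
    (∀ T' ∈ Ioo 0 T, ∃ C : ℝ, ∀ (i : Fin m) (n : ℤ), ∀ t ∈ Icc 0 T',
        lam ^ ((4 : ℝ) * n) * |X i n t| ≤ C) ∧
    (∀ M : ℝ, ∃ t ∈ Ico 0 T, ∃ (i : Fin m) (n : ℤ), M < lam ^ ((4 : ℝ) * n) * |X i n t|) ∧
    (∃ C : ℝ, ∀ (i : Fin m) (n : ℤ), ∀ t ∈ Ico 0 T,
        lam ^ ((3 / 5 : ℝ) * n) * |X i n t| ≤ C / Real.sqrt (T - t))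

/-- The abstract **shooting principle** behind card B (pure topology, proved): on the connected
parameter half-line, two disjoint nonempty open "exit" sets (downward exit `D` ∋ small amplitudes,
robust runaway `R` ∋ large amplitudes) leave a nonempty complement — the threshold parameters. -/
theorem shooting_principle (D R : Set ℝ) (hD : IsOpen D) (hR : IsOpen R)
    (hdisj : Disjoint D R) (a b : ℝ) (hab : a < b) (ha : a ∈ D) (hb : b ∈ R) :
    ∃ A ∈ Icc a b, A ∉ D ∧ A ∉ R := by
  by_contra h
  push_neg at h
  have hcover : Icc a b ⊆ D ∪ R := fun x hx => by
    by_cases hxD : x ∈ D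
    · exact Or.inl hxD
    · exact Or.inr (h x hx hxD)
  have hpre : IsPreconnected (Icc a b) := isPreconnected_Icc
  have := hpre.subset_or_subset hD hR hdisj hcover
  rcases this with hsub | hsub
  · exact (Set.disjoint_left.mp hdisj) (hsub (right_mem_Icc.mpr hab.le)) hb
  · exact (Set.disjoint_right.mp hdisj) (hsub (left_mem_Icc.mpr hab.le)) ha

end Summit.NavierStokesRegularity.NavierStokesRegularity.Cruxes.AveragedTypeIBlowup.SketchIdeator1

end
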